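import Mathlib
import HarnessLib
/-!
# The ℓ-reduced Elgindi-branch model's axis law never drains faster than the far tail — real algebra closing a twin pair

HONEST FRAMING (cell ns-blowup GROUP B «PROFILE SEARCH», zone Z6; human rulings D-0035/D-0074/D-0081): MODEL-of-MODEL **real algebra**
about the ℓ-REDUCED normal form of the ν = 0 axisymmetric NO-SWIRL EULER class-E profile system (profile-eng-10 g5,
HOME/profile/z6twin/asym/README §1 + LIMIT-ANALYSIS.md; kernel coefficients `ElgindiStrainModeCoefficients`, axis law `axisSlope_eq`
(p521760)). Not Navier–Stokes; «violates: none — MODEL (Euler)»; nothing about solutions is asserted here.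

CONTEXT. Along the axis the reduced model has `y′ = −2Λ/(m̃ + 4αΛ)` (`y = ln H`, `Λ = λ₀ − λ ∈ [0, λ₀]` the drained strain mass,
`λ₀ = (1+ε)/2` by the corner law, `m̃ = 1 − 2α(1+ε) = ε·m_char > 0` on the inflow side of the characteristic-reversal line), so in the
class `F = Γ z H` the decay rate of `F` per unit `s′` is `2Λ/(m̃ + 4αΛ) − 1`. A twin question between the two Z6 engineer seats
(STATUS 2026-08-27, eng-9 l.≈8896 (2) ↔ eng-10 REPLY ≈10:15Z (2)) was whether the interior could drain faster than the far tail (rate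
`ε = 1/(1+δ)`), as a «phase-2» caricature `(1−2α)/(2α) > ε` suggested; three codes (engine A full model, eng-10's reduced code, eng-9's
REDSL) showed the rate rising monotonically TO `ε` and never above. WHAT IS KERNEL-CHECKED: the algebra that makes this automatic for the
axis law — `mtilde_add_four_mul_lambda0` (`m̃ + 4αλ₀ = 1`), `axisFRate_at_lambda0` (at full drain `Λ = λ₀` the rate IS `ε`),
`axisFRate_mono` (the rate increases with `Λ` for `m̃ > 0`, `α ≥ 0`), `axisFRate_le_tailRate` (`0 ≤ Λ ≤ λ₀ ⇒ rate ≤ ε`). Companion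
identity (sibling file `ElgindiBranchKillSide`, Appendix 2): the caricature's excess over `ε` is `m_char/(2α(1+δ))`, zero only ON the
reversal line. PLACEMENT: cell-own lemma file (profile-eng-9 g2); bears on LADDER-NS N5/Z6 case Z6-1 (c) → N1 linear core (twin custody).
-/

namespace Summit.NavierStokesRegularity.OSWSelfSimilar
namespace ElgindiReducedAxisRate

/-- **Normalisation identity**: with `m̃ = 1 − 2α(1+ε)` and `λ₀ = (1+ε)/2`, `m̃ + 4αλ₀ = 1`.
[new here — MODEL-of-MODEL algebra; eng-10 LIMIT-ANALYSIS §2] -/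
theorem mtilde_add_four_mul_lambda0 (α ε : ℝ) :
    (1 - 2 * α * (1 + ε)) + 4 * α * ((1 + ε) / 2) = 1 := by
  ring

/-- **At full drain the axis F-rate IS the tail rate**: `2λ₀/(m̃ + 4αλ₀) − 1 = ε`.
[new here — MODEL-of-MODEL algebra] -/
theorem axisFRate_at_lambda0 (α ε : ℝ) :
    2 * ((1 + ε) / 2) / ((1 - 2 * α * (1 + ε)) + 4 * α * ((1 + ε) / 2)) - 1 = ε := by
  rw [mtilde_add_four_mul_lambda0, div_one]
  ring

/-- **The axis F-rate increases with the drained mass**: for `m̃ > 0`, `α ≥ 0` and `0 ≤ Λ₁ ≤ Λ₂`,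
`2Λ₁/(m̃ + 4αΛ₁) ≤ 2Λ₂/(m̃ + 4αΛ₂)`. [new here — MODEL-of-MODEL algebra] -/
theorem axisFRate_mono {m α Λ₁ Λ₂ : ℝ} (hm : 0 < m) (hα : 0 ≤ α) (h1 : 0 ≤ Λ₁) (h12 : Λ₁ ≤ Λ₂) :
    2 * Λ₁ / (m + 4 * α * Λ₁) ≤ 2 * Λ₂ / (m + 4 * α * Λ₂) := by
  have d1 : 0 < m + 4 * α * Λ₁ := by positivity
  have hΛ2 : 0 ≤ Λ₂ := le_trans h1 h12
  have d2 : 0 < m + 4 * α * Λ₂ := by positivity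
  rw [div_le_div_iff₀ d1 d2]
  nlinarith [mul_nonneg hα (sub_nonneg.2 h12)]

/-- **The reduced model's axis law never drains faster than the far tail.** For `m̃ = 1 − 2α(1+ε) > 0`, `α ≥ 0` and
`0 ≤ Λ ≤ λ₀ = (1+ε)/2`: `2Λ/(m̃ + 4αΛ) − 1 ≤ ε`, with equality at `Λ = λ₀` (`axisFRate_at_lambda0`). On every solution
`Λ ≤ λ₀`, so the caricature rate `(1−2α)/(2α) > ε` (sibling `ElgindiBranchKillSide.drainRate_gt_tailRate_iff`) is an unattained
supremum — the algebra behind the closed twin pair. [new here — MODEL-of-MODEL algebra; eng-10 `axisSlope_eq` p521760] -/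
theorem axisFRate_le_tailRate {α ε Λ : ℝ} (hm : 0 < 1 - 2 * α * (1 + ε)) (hα : 0 ≤ α) (hΛ : 0 ≤ Λ)
    (hΛ0 : Λ ≤ (1 + ε) / 2) :
    2 * Λ / ((1 - 2 * α * (1 + ε)) + 4 * α * Λ) - 1 ≤ ε := by
  have h := axisFRate_mono (m := 1 - 2 * α * (1 + ε)) hm hα hΛ hΛ0
  have h0 := axisFRate_at_lambda0 α ε
  linarith

end ElgindiReducedAxisRate
end Summit.NavierStokesRegularity.OSWSelfSimilar
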